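import Literature.Topology.FourManifolds.LatticeFormsEvenSublattice
import Literature.Topology.FourManifolds.LatticeFormsIndefiniteOdd
import HarnessLib

/-!
# Even indefinite unimodular lattices: Serre's Lemma 6 and Theorem 6 (type II)
(Serre, *A Course in Arithmetic*, Ch. V §3.5)

Trunk T-4MAN; part of the decomposition of the named fact
`LinearMap.BilinForm.equivalent_of_isIndefinite` (Serre, Ch. V §2.2 Thm 6).

* **Lemma 6** (`equivalent_hyperbolicForm_prod_of_equivalent_diag_prod`): for `F₁, F₂` even
  unimodular, `I₊ ⊕ I₋ ⊕ F₁ ≅ I₊ ⊕ I₋ ⊕ F₂` implies `U ⊕ F₁ ≅ U ⊕ F₂`.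
* **Theorem 6, type II** (`equivalent_of_isEven_of_isIndefinite`, from Theorem 3): two
  symmetric unimodular even indefinite lattices with the same rank and signature are isometric —
  Serre's "first part of the proof of Theorem 5".

## Proof of Lemma 6 (integral version of Serre's argument)

By `LatticeFormsEvenSublattice.lean` an isometry `I₊ ⊕ I₋ ⊕ F₁ ≅ I₊ ⊕ I₋ ⊕ F₂` restricts to the
even sublattices, `ψ : Λ ⊕ F₁ ≅ Λ ⊕ F₂` (`Λ` = Gram `!![0,2;2,0]`), and `Λ ⊕ Fᵢ` sits in
`U ⊕ Fᵢ` as `ι(Λ ⊕ Fᵢ) = 2ℤ e₀ ⊕ ℤ e₁ ⊕ Fᵢ`, of index `2`. Serre: the lattices strictly between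
`E⁰` and its dual `E⁺` are `E` (odd) and `E', E'' ≅ U ⊕ F`, and `f` permutes them preserving
parity. Concretely: `U ⊕ F₁ = ι(Λ ⊕ F₁) + ℤ e₀` with `2 e₀ = ι(e₀)`; put
`u = ψ(e₀, 0) = ((α, β), g)`. Pairing `u` with `Λ ⊕ F₂ = ψ(Λ ⊕ F₁)` gives even numbers only
(as `e₀` does), so `g = 2g'` by unimodularity of `F₂` (`exists_eq_smul_of_forall_dvd`), and
`u.u = 0` gives `αβ = −F₂(g', g')`, even: so `α` or `β` is even (the two even neighbours
`E', E''`). If `β` is even, `û = ((α, β/2), g') ∈ U ⊕ F₂` satisfies `2û = ι(u)`, and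
`Ψ(a e₀ + ι(l)) = a û + ι(ψ l)`, i.e. `Ψ((a₀, a₁), f) = a₀ û + ι ψ((0, a₁), f)`, is an isometry
`U ⊕ F₁ ≅ U ⊕ F₂` (`4·` both sides reduces to `ψ` being one; it is injective by unimodularity and
surjective because `α` is then odd). If `α` is even, compose `ψ` first with the swap of the two
coordinates of `Λ`, an isometry of `Λ ⊕ F₂`.

`ℤ`-lattices carry the canonical structure `AddCommGroup.toIntModule` (only `[AddCommGroup M]` is
assumed), see `LatticeFormsOrthoSum.lean`.

## Sources

* J.-P. Serre, *A Course in Arithmetic* (GTM 7, Springer 1973), Ch. V §3.5 (Lemma 5, Lemma 6,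
  proof of Theorem 5), §2.2 Thms 5–6. [Serre1973]
* J. Milnor, D. Husemoller, *Symmetric bilinear forms* (Springer 1973), Ch. II §5 (Thm 5.3).
  [MilnorHusemoller1973]
-/

open Module
open LinearMap (BilinForm)
open scoped Matrix

universe u v

namespace Literature.Topology.FourManifolds

open LinearMap.BilinForm

section Lemma6

variable {M₁ M₂ : Type*} [AddCommGroup M₁] [AddCommGroup M₂] {F₁ : BilinForm ℤ M₁}
  {F₂ : BilinForm ℤ M₂}

/-- In `Λ ⊕ F`, the vector `(e₀, 0)` pairs evenly with everything (`Λ e₀ v = 2 v₁`); hence so does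
its image `u` under an isometry `ψ : Λ ⊕ F₁ ≅ Λ ⊕ F₂` ("`E₁⁺` onto `E₂⁺`").
[cite: Serre1973, Ch. V §3.5 Lemma 6] -/
theorem even_apply_image_single
    (ψ : ((Matrix.toBilin' !![(0 : ℤ), 2; 2, 0]).prod F₁).IsometryEquiv
      ((Matrix.toBilin' !![(0 : ℤ), 2; 2, 0]).prod F₂))
    (l : (Fin 2 → ℤ) × M₂) :
    Even (((Matrix.toBilin' !![(0 : ℤ), 2; 2, 0]).prod F₂) (ψ (Pi.single 0 1, 0)) l) := by
  obtain ⟨l', rfl⟩ := (ψ : ((Fin 2 → ℤ) × M₁) ≃ₗ[ℤ] ((Fin 2 → ℤ) × M₂)).surjective l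
  change Even (((Matrix.toBilin' !![(0 : ℤ), 2; 2, 0]).prod F₂) (ψ (Pi.single 0 1, 0)) (ψ l'))
  rw [ψ.map_app, prod_apply, toBilin'_twoHyperbolic_apply]
  simp

/-- The `F₂`-component of `u = ψ(e₀, 0)` is divisible by `2` (unimodularity of `F₂`,
`exists_eq_smul_of_forall_dvd`). [cite: Serre1973, Ch. V §3.5 Lemma 6] -/
theorem exists_snd_image_single_eq_two_smul (hu₂ : F₂.IsUnimodular)
    (ψ : ((Matrix.toBilin' !![(0 : ℤ), 2; 2, 0]).prod F₁).IsometryEquiv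
      ((Matrix.toBilin' !![(0 : ℤ), 2; 2, 0]).prod F₂)) :
    ∃ g' : M₂, (ψ (Pi.single 0 1, 0)).2 = (2 : ℤ) • g' := by
  haveI : F₂.IsPerfPair := hu₂
  refine exists_eq_smul_of_forall_dvd (B := F₂) fun f => ?_
  have h := even_apply_image_single ψ (0, f)
  simp only [prod_apply, map_zero, zero_add] at h
  exact h.two_dvd

/-- `u = ψ(e₀, 0) = ((α, β), g)` has `αβ` even: `u.u = 0` reads `4αβ + F₂(g, g) = 0` with
`g = 2g'` and `F₂(g', g')` even. (The two even neighbours `E'`, `E''` of `E⁰`.)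
[cite: Serre1973, Ch. V §3.5 Lemma 6] -/
theorem even_fst_mul_fst_image_single (hu₂ : F₂.IsUnimodular) (hF₂ : F₂.IsEven)
    (ψ : ((Matrix.toBilin' !![(0 : ℤ), 2; 2, 0]).prod F₁).IsometryEquiv
      ((Matrix.toBilin' !![(0 : ℤ), 2; 2, 0]).prod F₂)) :
    Even ((ψ (Pi.single 0 1, 0)).1 0 * (ψ (Pi.single 0 1, 0)).1 1) := by
  obtain ⟨g', hg'⟩ := exists_snd_image_single_eq_two_smul hu₂ ψ
  obtain ⟨k, hk⟩ := hF₂ g'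
  have hnorm : ((Matrix.toBilin' !![(0 : ℤ), 2; 2, 0]).prod F₂) (ψ (Pi.single 0 1, 0))
      (ψ (Pi.single 0 1, 0)) = 0 := by
    rw [ψ.map_app, prod_apply, toBilin'_twoHyperbolic_apply]
    simp
  rw [prod_apply, toBilin'_twoHyperbolic_apply, hg', LinearMap.BilinForm.smul_left,
    LinearMap.BilinForm.smul_right, hk, mul_comm ((ψ (Pi.single 0 1, 0)).1 1)] at hnorm
  exact ⟨-k, by omega⟩

/-- **Lemma 6, extension step.** Let `F₁, F₂` be unimodular, `F₂` even, and
`ψ : Λ ⊕ F₁ ≅ Λ ⊕ F₂` an isometry such that the `e₁`-coordinate `β` of `u = ψ(e₀, 0)` is even.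
Then `U ⊕ F₁ ≅ U ⊕ F₂`, by `Ψ((a₀, a₁), f) = a₀ û + ι ψ((0, a₁), f)` with `2û = ι(u)` (see the
file header; Serre: "`f` carries `E₁'` onto `E₂'` or `E₂''`, both `≅ U ⊕ F₂`").
[cite: Serre1973, Ch. V §3.5 Lemma 6] -/
theorem equivalent_hyperbolicForm_prod_of_isometryEquiv_of_even (hu₁ : F₁.IsUnimodular)
    (hu₂ : F₂.IsUnimodular)
    (ψ : ((Matrix.toBilin' !![(0 : ℤ), 2; 2, 0]).prod F₁).IsometryEquiv
      ((Matrix.toBilin' !![(0 : ℤ), 2; 2, 0]).prod F₂))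
    (hβ : Even ((ψ (Pi.single 0 1, 0)).1 1)) :
    (hyperbolicForm.prod F₁).Equivalent (hyperbolicForm.prod F₂) := by
  -- the inclusions `ι : Λ ⊕ Fᵢ → U ⊕ Fᵢ`
  let ι₁ : ((Fin 2 → ℤ) × M₁) →ₗ[ℤ] ((Fin 2 → ℤ) × M₁) :=
    LinearMap.prodMap (Matrix.mulVecLin !![(2 : ℤ), 0; 0, 1]) (LinearMap.id (M := M₁) (R := ℤ))
  let ι₂ : ((Fin 2 → ℤ) × M₂) →ₗ[ℤ] ((Fin 2 → ℤ) × M₂) :=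
    LinearMap.prodMap (Matrix.mulVecLin !![(2 : ℤ), 0; 0, 1]) (LinearMap.id (M := M₂) (R := ℤ))
  have hι₁_apply : ∀ l : (Fin 2 → ℤ) × M₁, ι₁ l = (![2 * l.1 0, l.1 1], l.2) := fun l => by
    simp only [ι₁, LinearMap.prodMap_apply, Matrix.mulVecLin_apply, mulVec_iota, LinearMap.id_apply]
  have hι₂_apply : ∀ l : (Fin 2 → ℤ) × M₂, ι₂ l = (![2 * l.1 0, l.1 1], l.2) := fun l => by
    simp only [ι₂, LinearMap.prodMap_apply, Matrix.mulVecLin_apply, mulVec_iota, LinearMap.id_apply]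
  -- `x₁ = (e₀, 0)`, `u = ψ x₁ = ((α, β), g)` with `g = 2 g'`, `β = 2 β'`
  set x₁ : (Fin 2 → ℤ) × M₁ := (Pi.single 0 1, 0) with hx₁
  obtain ⟨g', hg'⟩ := exists_snd_image_single_eq_two_smul hu₂ ψ
  obtain ⟨β', hβ'⟩ := hβ
  -- `û` with `2 û = ι u`
  set û : (Fin 2 → ℤ) × M₂ := (![(ψ x₁).1 0, β'], g') with hû
  have h2û : (2 : ℤ) • û = ι₂ (ψ x₁) := by
    rw [hι₂_apply]
    refine Prod.ext ?_ ?_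
    · change (2 : ℤ) • ![(ψ x₁).1 0, β'] = ![2 * (ψ x₁).1 0, (ψ x₁).1 1]
      refine ((vec2_eq_iff _ _ _).mpr ⟨?_, ?_⟩).symm
      · simp
      · simp only [Pi.smul_apply, Matrix.cons_val_one, Matrix.cons_val_fin_one, smul_eq_mul]
        omega
    · change (2 : ℤ) • g' = (ψ x₁).2
      exact hg'.symm
  -- the map `Ψ v = v₀ • û + ι₂ (ψ ((0, v₁), f))`
  let j₁ : ((Fin 2 → ℤ) × M₁) →ₗ[ℤ] ((Fin 2 → ℤ) × M₁) :=
    LinearMap.prodMap (Matrix.mulVecLin !![(0 : ℤ), 0; 0, 1]) (LinearMap.id (M := M₁) (R := ℤ))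
  have hj₁ : ∀ v : (Fin 2 → ℤ) × M₁, j₁ v = (![0, v.1 1], v.2) := fun v => by
    simp only [j₁, LinearMap.prodMap_apply, Matrix.mulVecLin_apply, LinearMap.id_apply]
    refine Prod.ext ?_ rfl
    ext i
    fin_cases i <;> simp [Matrix.mulVec, dotProduct, Fin.sum_univ_two]
  let π₀ : ((Fin 2 → ℤ) × M₁) →ₗ[ℤ] ℤ := (LinearMap.proj 0).comp (LinearMap.fst ℤ (Fin 2 → ℤ) M₁)
  let Ψ : ((Fin 2 → ℤ) × M₁) →ₗ[ℤ] ((Fin 2 → ℤ) × M₂) :=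
    π₀.smulRight û + ι₂.comp ((ψ : ((Fin 2 → ℤ) × M₁) ≃ₗ[ℤ] ((Fin 2 → ℤ) × M₂)).toLinearMap.comp j₁)
  have hΨ : ∀ v : (Fin 2 → ℤ) × M₁, Ψ v = (v.1 0) • û + ι₂ (ψ (![0, v.1 1], v.2)) := fun v => by
    simp only [Ψ, π₀, LinearMap.add_apply, LinearMap.smulRight_apply, LinearMap.coe_comp,
      Function.comp_apply, LinearMap.coe_proj, LinearMap.fst_apply, Function.eval,
      LinearEquiv.coe_coe, hj₁]
    rfl
  -- `v = v₀ • x₁ + ((0, v₁), f)`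
  have hdecomp : ∀ v : (Fin 2 → ℤ) × M₁,
      (v.1 0) • x₁ + (((![0, v.1 1] : Fin 2 → ℤ), v.2) : (Fin 2 → ℤ) × M₁) = v := fun v => by
    refine Prod.ext ?_ (by simp [hx₁])
    change (v.1 0) • (Pi.single 0 1 : Fin 2 → ℤ) + ![0, v.1 1] = v.1
    ext i
    fin_cases i <;> simp
  have hΨι : ∀ l : (Fin 2 → ℤ) × M₁, Ψ (ι₁ l) = ι₂ (ψ l) := fun l => by
    rw [hΨ, hι₁_apply]
    simp only [Matrix.cons_val_zero, Matrix.cons_val_one]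
    rw [mul_comm, mul_smul, h2û, ← map_smul, ← map_smul, ← map_add, ← map_add, hdecomp l]
  have hΨx : Ψ x₁ = û := by
    rw [hΨ]
    have h0 : (((![0, x₁.1 1] : Fin 2 → ℤ), x₁.2) : (Fin 2 → ℤ) × M₁) = 0 := by
      refine Prod.ext ?_ (by simp [hx₁])
      change (![0, x₁.1 1] : Fin 2 → ℤ) = 0
      ext i
      fin_cases i <;> simp [hx₁]
    rw [h0, map_zero, map_zero, add_zero]
    simp [hx₁]
  -- key identity: `2 • Ψ v = ι₂ (ψ θv)` with `ι₁ θv = 2 • v`, `θv = ((v₀, 2 v₁), 2 f)`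
  have hθ : ∀ v : (Fin 2 → ℤ) × M₁, (v.1 0) • x₁ + (2 : ℤ) • (((![0, v.1 1] : Fin 2 → ℤ), v.2) :
      (Fin 2 → ℤ) × M₁) = (![v.1 0, 2 * v.1 1], (2 : ℤ) • v.2) := fun v => by
    refine Prod.ext ?_ (by simp [hx₁])
    change (v.1 0) • (Pi.single 0 1 : Fin 2 → ℤ) + (2 : ℤ) • ![0, v.1 1] = ![v.1 0, 2 * v.1 1]
    ext i
    fin_cases i <;> simp
  have h2Ψ : ∀ v : (Fin 2 → ℤ) × M₁,
      (2 : ℤ) • Ψ v = ι₂ (ψ (![v.1 0, 2 * v.1 1], (2 : ℤ) • v.2)) := fun v => by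
    rw [hΨ, smul_add, smul_comm (2 : ℤ) (v.1 0) û, h2û, ← map_smul, ← map_smul, ← map_smul,
      ← map_smul, ← map_add, ← map_add, hθ v]
  have hιθ : ∀ v : (Fin 2 → ℤ) × M₁,
      ι₁ (![v.1 0, 2 * v.1 1], (2 : ℤ) • v.2) = (2 : ℤ) • v := fun v => by
    rw [hι₁_apply]
    refine Prod.ext ?_ rfl
    change (![2 * (![v.1 0, 2 * v.1 1] : Fin 2 → ℤ) 0, (![v.1 0, 2 * v.1 1] : Fin 2 → ℤ) 1] :
      Fin 2 → ℤ) = (2 : ℤ) • v.1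
    ext i
    fin_cases i <;> simp
  -- `Ψ` is isometric
  have hiso : ∀ v w : (Fin 2 → ℤ) × M₁,
      (hyperbolicForm.prod F₂) (Ψ v) (Ψ w) = (hyperbolicForm.prod F₁) v w := fun v w => by
    have h4 : (4 : ℤ) * (hyperbolicForm.prod F₂) (Ψ v) (Ψ w) =
        4 * (hyperbolicForm.prod F₁) v w := by
      calc (4 : ℤ) * (hyperbolicForm.prod F₂) (Ψ v) (Ψ w)
          = (hyperbolicForm.prod F₂) ((2 : ℤ) • Ψ v) ((2 : ℤ) • Ψ w) := by
            rw [LinearMap.BilinForm.smul_left, LinearMap.BilinForm.smul_right]; ring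
        _ = ((Matrix.toBilin' !![(0 : ℤ), 2; 2, 0]).prod F₂)
              (ψ (![v.1 0, 2 * v.1 1], (2 : ℤ) • v.2)) (ψ (![w.1 0, 2 * w.1 1], (2 : ℤ) • w.2)) := by
            rw [h2Ψ, h2Ψ]
            exact hyperbolicForm_prod_iota_apply F₂ _ _
        _ = ((Matrix.toBilin' !![(0 : ℤ), 2; 2, 0]).prod F₁)
              (![v.1 0, 2 * v.1 1], (2 : ℤ) • v.2) (![w.1 0, 2 * w.1 1], (2 : ℤ) • w.2) :=
            ψ.map_app _ _
        _ = (hyperbolicForm.prod F₁) (ι₁ (![v.1 0, 2 * v.1 1], (2 : ℤ) • v.2))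
              (ι₁ (![w.1 0, 2 * w.1 1], (2 : ℤ) • w.2)) :=
            (hyperbolicForm_prod_iota_apply F₁ _ _).symm
        _ = (hyperbolicForm.prod F₁) ((2 : ℤ) • v) ((2 : ℤ) • w) := by rw [hιθ, hιθ]
        _ = 4 * (hyperbolicForm.prod F₁) v w := by
            rw [LinearMap.BilinForm.smul_left, LinearMap.BilinForm.smul_right]; ring
    exact mul_left_cancel₀ (by norm_num : (4 : ℤ) ≠ 0) h4
  -- `Ψ` is injective (`U ⊕ F₁` is unimodular, hence nondegenerate)
  have hH₁u : (hyperbolicForm.prod F₁).IsUnimodular :=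
    isUnimodular_prod_iff.mpr ⟨isUnimodular_hyperbolicForm_holds, hu₁⟩
  have hinj : Function.Injective Ψ := fun v w hvw => by
    have h0 : ∀ z, (hyperbolicForm.prod F₁) (v - w) z = 0 := fun z => by
      rw [← hiso, map_sub, map_sub, LinearMap.sub_apply, hvw, sub_self]
    exact sub_eq_zero.mp (hH₁u.separatingLeft _ h0)
  -- `α = (ψ x₁).1 0` is odd (else `u ∈ 2 (Λ ⊕ F₂)` and `x₁ ∈ 2 (Λ ⊕ F₁)`)
  have hss : ∀ z : (Fin 2 → ℤ) × M₂, ψ (ψ.symm z) = z := fun z =>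
    (ψ : ((Fin 2 → ℤ) × M₁) ≃ₗ[ℤ] ((Fin 2 → ℤ) × M₂)).apply_symm_apply z
  have hα : ¬ Even ((ψ x₁).1 0) := by
    rintro ⟨α', hα'⟩
    have hu2 : ψ x₁ = (2 : ℤ) • (((![α', β'] : Fin 2 → ℤ), g') : (Fin 2 → ℤ) × M₂) := by
      refine Prod.ext ?_ (by simpa using hg')
      change (ψ x₁).1 = (2 : ℤ) • ![α', β']
      ext i
      fin_cases i
      · simp only [Fin.zero_eta, Pi.smul_apply, Matrix.cons_val_zero, smul_eq_mul]
        omega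
      · simp only [Fin.mk_one, Pi.smul_apply, Matrix.cons_val_one, Matrix.cons_val_fin_one,
          smul_eq_mul]
        omega
    have hx2 : x₁ = (2 : ℤ) • ψ.symm (((![α', β'] : Fin 2 → ℤ), g') : (Fin 2 → ℤ) × M₂) := by
      apply (ψ : ((Fin 2 → ℤ) × M₁) ≃ₗ[ℤ] ((Fin 2 → ℤ) × M₂)).injective
      change ψ x₁ = ψ ((2 : ℤ) • ψ.symm (((![α', β'] : Fin 2 → ℤ), g') : (Fin 2 → ℤ) × M₂))
      rw [map_smul, hss, ← hu2]
    have h10 := congr_fun (congrArg Prod.fst hx2) 0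
    simp only [hx₁, Pi.single_eq_same, Prod.smul_fst, Pi.smul_apply, smul_eq_mul] at h10
    omega
  -- `Ψ` is surjective
  have hsurj : Function.Surjective Ψ := fun t => by
    obtain ⟨r, hr⟩ : Odd ((ψ x₁).1 0) := Int.not_even_iff_odd.mp hα
    set s : ℤ := t.1 0 * (ψ x₁).1 0 with hs
    have hmem : t - s • û ∈ LinearMap.range ι₂ := by
      refine (mem_range_iota_iff _).mpr ?_
      simp only [Prod.fst_sub, Pi.sub_apply, Prod.smul_fst, Pi.smul_apply, smul_eq_mul, hû,
        Matrix.cons_val_zero, hs, hr]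
      -- `t₀ - t₀ α α` with `α = 2r + 1` odd
      exact ⟨-(t.1 0) * (2 * r * r + 2 * r), by ring⟩
    obtain ⟨l₂, hl₂⟩ := LinearMap.mem_range.mp hmem
    refine ⟨s • x₁ + ι₁ (ψ.symm l₂), ?_⟩
    rw [map_add, map_smul, hΨx, hΨι, hss, hl₂]
    abel
  exact ⟨{ LinearEquiv.ofBijective Ψ ⟨hinj, hsurj⟩ with
    map_app' := fun v w => by
      show (hyperbolicForm.prod F₂) (LinearEquiv.ofBijective Ψ ⟨hinj, hsurj⟩ v)
        (LinearEquiv.ofBijective Ψ ⟨hinj, hsurj⟩ w) = (hyperbolicForm.prod F₁) v w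
      rw [LinearEquiv.ofBijective_apply, LinearEquiv.ofBijective_apply, hiso] }⟩

/-- **Lemma 6, from the even sublattices**: for `F₁, F₂` unimodular with `F₂` even, an isometry
`Λ ⊕ F₁ ≅ Λ ⊕ F₂` yields `U ⊕ F₁ ≅ U ⊕ F₂`: either the `e₁`-coordinate of `u = ψ(e₀,0)` is
even and the previous result applies, or its `e₀`-coordinate is (`even_fst_mul_fst_image_single`)
and one first swaps the two coordinates of `Λ` (an isometry of `Λ ⊕ F₂`) — "it carries
`(E₁', E₁'')` onto either `(E₂', E₂'')` or `(E₂'', E₂')`".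
[cite: Serre1973, Ch. V §3.5 Lemma 6] -/
theorem equivalent_hyperbolicForm_prod_of_equivalent_twoHyperbolic_prod (hu₁ : F₁.IsUnimodular)
    (hu₂ : F₂.IsUnimodular) (hF₂ : F₂.IsEven)
    (h : ((Matrix.toBilin' !![(0 : ℤ), 2; 2, 0]).prod F₁).Equivalent
      ((Matrix.toBilin' !![(0 : ℤ), 2; 2, 0]).prod F₂)) :
    (hyperbolicForm.prod F₁).Equivalent (hyperbolicForm.prod F₂) := by
  obtain ⟨ψ⟩ := h
  rcases Int.even_mul.mp (even_fst_mul_fst_image_single hu₂ hF₂ ψ) with hα | hβ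
  · -- swap the coordinates of `Λ` first
    let σ : (Fin 2 → ℤ) ≃ₗ[ℤ] (Fin 2 → ℤ) := LinearEquiv.funCongrLeft ℤ ℤ (Equiv.swap 0 1)
    have hσ : ∀ x : Fin 2 → ℤ, σ x = ![x 1, x 0] := fun x => by
      ext i
      fin_cases i
      · simp [σ, LinearEquiv.funCongrLeft_apply, Equiv.swap_apply_left]
      · simp [σ, LinearEquiv.funCongrLeft_apply, Equiv.swap_apply_right]
    let sw : ((Matrix.toBilin' !![(0 : ℤ), 2; 2, 0]).prod F₂).IsometryEquiv
        ((Matrix.toBilin' !![(0 : ℤ), 2; 2, 0]).prod F₂) :=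
      { σ.prodCongr (LinearEquiv.refl ℤ M₂) with
        map_app' := fun v w => by
          show ((Matrix.toBilin' !![(0 : ℤ), 2; 2, 0]).prod F₂) (σ v.1, v.2) (σ w.1, w.2) =
            ((Matrix.toBilin' !![(0 : ℤ), 2; 2, 0]).prod F₂) v w
          rw [prod_apply, prod_apply, hσ, hσ, toBilin'_twoHyperbolic_apply,
            toBilin'_twoHyperbolic_apply]
          simp only [Matrix.cons_val_zero, Matrix.cons_val_one]
          ring }
    refine equivalent_hyperbolicForm_prod_of_isometryEquiv_of_even hu₁ hu₂ (ψ.trans sw) ?_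
    change Even ((sw (ψ (Pi.single 0 1, 0))).1 1)
    change Even ((σ (ψ (Pi.single 0 1, 0)).1, (ψ (Pi.single 0 1, 0)).2).1 1)
    rw [hσ]
    simpa using hα
  · exact equivalent_hyperbolicForm_prod_of_isometryEquiv_of_even hu₁ hu₂ ψ hβ

/-- **Serre's Lemma 6.** Let `F₁, F₂` be even (type II) unimodular lattices with
`I₊ ⊕ I₋ ⊕ F₁ ≅ I₊ ⊕ I₋ ⊕ F₂`. Then `U ⊕ F₁ ≅ U ⊕ F₂` (Serre, *A Course in Arithmetic*, Ch. V
§3.5 Lemma 6; `U = hyperbolicForm`, `I₊ ⊕ I₋ = Matrix.toBilin' (diagonal ![1, -1])`).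
[cite: Serre1973, Ch. V §3.5 Lemma 6] -/
theorem equivalent_hyperbolicForm_prod_of_equivalent_diag_prod (hF₁ : F₁.IsEven) (hF₂ : F₂.IsEven)
    (hu₁ : F₁.IsUnimodular) (hu₂ : F₂.IsUnimodular)
    (h : ((Matrix.toBilin' (Matrix.diagonal ![(1 : ℤ), -1])).prod F₁).Equivalent
      ((Matrix.toBilin' (Matrix.diagonal ![(1 : ℤ), -1])).prod F₂)) :
    (hyperbolicForm.prod F₁).Equivalent (hyperbolicForm.prod F₂) :=
  equivalent_hyperbolicForm_prod_of_equivalent_twoHyperbolic_prod hu₁ hu₂ hF₂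
    (equivalent_twoHyperbolic_prod_of_equivalent_diag_prod hF₁ hF₂ hu₁ h)

end Lemma6

/-- `I₊ ⊕ I₋` is of type I. Serre, *A Course in Arithmetic*, Ch. V §1.4.1.
[cite: Serre1973, Ch. V §1.4.1] -/
theorem isOdd_toBilin'_diagonal_one_neg_one :
    (Matrix.toBilin' (Matrix.diagonal ![(1 : ℤ), -1])).IsOdd :=
  isOdd_toBilin'_diagonal_of_isUnit fun i => by fin_cases i <;> simp

end Literature.Topology.FourManifolds

namespace LinearMap.BilinForm

open Literature.Topology.FourManifolds

/-- **Theorem 6, type II case** (from Theorem 3; Serre's "first part of the proof of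
Theorem 5"). Two symmetric unimodular even indefinite lattices with the same rank and the same
signature are isometric: by Lemma 5, `Eᵢ ≅ U ⊕ Fᵢ` with `Fᵢ` even unimodular; `I₊ ⊕ I₋ ⊕ F₁`
and `I₊ ⊕ I₋ ⊕ F₂` are odd, indefinite, unimodular, of the same rank and index
(`signature_hyperbolicForm_prod_eq`), hence isomorphic by Theorem 4; and Lemma 6 gives
`U ⊕ F₁ ≅ U ⊕ F₂` (Serre, *A Course in Arithmetic*, Ch. V §3.5). The hypotheses `h3`, `h3'`
are Serre's Theorem 3 in the universes of `M`, `M'`. [cite: Serre1973, Ch. V §2.2 Thm 6, §3.5] -/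
theorem equivalent_of_isEven_of_isIndefinite (h3 : exists_isotropic_of_isIndefinite.{u})
    (h3' : exists_isotropic_of_isIndefinite.{v})
    {M : Type u} {M' : Type v} [AddCommGroup M] [Module.Finite ℤ M] [Module.Free ℤ M]
    [AddCommGroup M'] [Module.Finite ℤ M'] [Module.Free ℤ M']
    {B : BilinForm ℤ M} {B' : BilinForm ℤ M'}
    (hB : B.IsSymm) (hu : B.IsUnimodular) (heven : B.IsEven) (hind : B.IsIndefinite)
    (hB' : B'.IsSymm) (hu' : B'.IsUnimodular) (heven' : B'.IsEven) (hind' : B'.IsIndefinite)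
    (hrank : finrank ℤ M = finrank ℤ M') (hsig : B.signature = B'.signature) :
    B.Equivalent B' := by
  -- Lemma 5 for `B`
  haveI : B.IsPerfPair := hu
  obtain ⟨x₀, hx₀0, hx₀⟩ := h3 B hB hu hind
  obtain ⟨x, y, hx, hxy⟩ := exists_isotropic_dual_pair hx₀0 hx₀
  obtain ⟨y', hy', hxy'⟩ := exists_hyperbolic_pair_of_isEven hB heven hx hxy
  let e := IsometryEquiv.splitHyperbolic hB x y' hx hy' hxy'
  set W := B.orthogonal (Submodule.span ℤ {x, y'}) with hW
  have hFu : (B.restrict W).IsUnimodular := isUnimodular_restrict_orthogonal_pair hu hB x y' hx hy' hxy'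
  have hFe : (B.restrict W).IsEven := fun w => heven w
  have hFs : (B.restrict W).IsSymm := hB.restrict W
  -- Lemma 5 for `B'`
  haveI : B'.IsPerfPair := hu'
  obtain ⟨x₀', hx₀0', hx₀'⟩ := h3' B' hB' hu' hind'
  obtain ⟨z, t, hz, hzt⟩ := exists_isotropic_dual_pair hx₀0' hx₀'
  obtain ⟨t', ht', hzt'⟩ := exists_hyperbolic_pair_of_isEven hB' heven' hz hzt
  let e' := IsometryEquiv.splitHyperbolic hB' z t' hz ht' hzt'
  set W' := B'.orthogonal (Submodule.span ℤ {z, t'}) with hW'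
  have hFu' : (B'.restrict W').IsUnimodular :=
    isUnimodular_restrict_orthogonal_pair hu' hB' z t' hz ht' hzt'
  have hFe' : (B'.restrict W').IsEven := fun w => heven' w
  have hFs' : (B'.restrict W').IsSymm := hB'.restrict W'
  -- ranks and signatures of `I₊ ⊕ I₋ ⊕ F`, `I₊ ⊕ I₋ ⊕ F'`
  have hr : finrank ℤ ((Fin 2 → ℤ) × W) = finrank ℤ ((Fin 2 → ℤ) × W') := by
    rw [← (e : M ≃ₗ[ℤ] ((Fin 2 → ℤ) × W)).finrank_eq, ← (e' : M' ≃ₗ[ℤ] ((Fin 2 → ℤ) × W')).finrank_eq,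
      hrank]
  have hs : ((Matrix.toBilin' (Matrix.diagonal ![(1 : ℤ), -1])).prod (B.restrict W)).signature =
      ((Matrix.toBilin' (Matrix.diagonal ![(1 : ℤ), -1])).prod (B'.restrict W')).signature := by
    rw [← signature_hyperbolicForm_prod_eq, ← signature_hyperbolicForm_prod_eq,
      ← signature_eq_of_equivalent ⟨e⟩, ← signature_eq_of_equivalent ⟨e'⟩, hsig]
  -- Theorem 4 (type I) for `I₊ ⊕ I₋ ⊕ F ≅ I₊ ⊕ I₋ ⊕ F'`
  have hD : ((Matrix.toBilin' (Matrix.diagonal ![(1 : ℤ), -1])).prod (B.restrict W)).Equivalent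
      ((Matrix.toBilin' (Matrix.diagonal ![(1 : ℤ), -1])).prod (B'.restrict W')) :=
    equivalent_of_isOdd_of_isIndefinite h3 h3'
      (isSymm_toBilin'_diagonal_one_neg_one.prod hFs)
      (isUnimodular_prod_iff.mpr ⟨isUnimodular_toBilin'_diagonal_one_neg_one, hFu⟩)
      (isOdd_prod_of_left isOdd_toBilin'_diagonal_one_neg_one)
      (isIndefinite_toBilin'_diagonal_one_neg_one_prod _)
      (isSymm_toBilin'_diagonal_one_neg_one.prod hFs')
      (isUnimodular_prod_iff.mpr ⟨isUnimodular_toBilin'_diagonal_one_neg_one, hFu'⟩)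
      (isOdd_prod_of_left isOdd_toBilin'_diagonal_one_neg_one)
      (isIndefinite_toBilin'_diagonal_one_neg_one_prod _) hr hs
  -- Lemma 6
  have hU := equivalent_hyperbolicForm_prod_of_equivalent_diag_prod hFe hFe' hFu hFu' hD
  exact Equivalent.trans ⟨e⟩ (Equivalent.trans hU ⟨e'.symm⟩)

end LinearMap.BilinForm
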